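import Literature.NumberTheory.NumberFields.ArithmeticEquivalenceGassmannProofs
import Literature.NumberTheory.LFunctions.DedekindZetaProofs
import Literature.NumberTheory.LFunctions.AbelianFieldDedekindZeta
import Literature.NumberTheory.LFunctions.DedekindZeta
import HarnessLib

/-!
# Crux `DedekindQuotientEntire` (stmt-Langlands-17271), line `Sketch` — stub C `completeThenMultiply`

The analytic glue "complete, then multiply — never divide".  Write `x := p^{-s}` and
`F_K(p,s) := (∏_{f ∈ splittingType K p} (1 - x^f)⁻¹)·(1 - x)` (`= ζ_{K,p}(s)(1 - p^{-s})`).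
If `∏_{p ∉ T} F_K(p,s)` converges to an entire `g₀` for `Re s > σ₀` (finite `T`) and `ζ_K` has
its Euler product regrouped along the rational primes on `Re s > 1`, then
`g := g₀ · ∏_{p ∈ T} F_K(p,·)` is holomorphic on `Re s > 0` and `g·ζ = ζ_K` on `Re s > 1`:
complete the partial product by its finite part (`Finset.hasProd` + `HasProd.mul_compl`, monoid
surgery), multiply by the Euler product of `ζ` (`riemannZeta_eulerProduct_hasProd`), compare with
`ζ_K` termwise (`HasProd.unique`) on `Re s > max σ₀ 1`, and pass to all of `Re s > 1` by the
identity principle on the convex half-plane.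

This stub is `π`-free: it needs neither the route's Theses module nor anything automorphic, only
`splittingType` (Perlis), Mathlib's `NumberField.dedekindZeta` / `riemannZeta` and the tree's
`LSeriesSummable_dedekindZeta`.
-/

set_option linter.dupNamespace false

noncomputable section

open scoped NumberField
open Polynomial Complex Filter IsDedekindDomain
open Literature.NumberTheory.LFunctions Literature.NumberTheory.LFunctions.NumberField
open Literature.NumberTheory.NumberFields
open Literature.NumberTheory.GaloisRepresentations

namespace Summit.Langlands.Langlands.Theorems.DedekindQuotientEntire

/-- `1 - (p^{-s})^f ≠ 0` for a prime `p`, `Re s > 0` and `f > 0` (since `‖p^{-s}‖ = p^{-Re s} < 1`). -/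
private theorem ctm_one_sub_pow_ne_zero (p : Nat.Primes) {s : ℂ} (hs : 0 < s.re) {f : ℕ}
    (hf : 0 < f) : 1 - (((p : ℕ) : ℂ) ^ (-s)) ^ f ≠ 0 := by
  intro h
  have hx : ‖((p : ℕ) : ℂ) ^ (-s)‖ < 1 := by
    rw [Complex.norm_natCast_cpow_of_pos p.2.pos, Complex.neg_re]
    exact Real.rpow_lt_one_of_one_lt_of_neg (by exact_mod_cast p.2.one_lt) (by linarith)
  have h1 : (((p : ℕ) : ℂ) ^ (-s)) ^ f = 1 := (sub_eq_zero.mp h).symm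
  have hlt : ‖(((p : ℕ) : ℂ) ^ (-s)) ^ f‖ < 1 := by
    rw [norm_pow]
    exact pow_lt_one₀ (norm_nonneg _) hx hf.ne'
  rw [h1, norm_one] at hlt
  exact lt_irrefl _ hlt

/-- Each factor `F_K(p,·) = (∏_{f ∈ splittingType K p} (1 - p^{-fs})⁻¹)·(1 - p^{-s})` is
complex differentiable at every `s` with `Re s > 0`. -/
private theorem ctm_differentiableAt_factor (K : Type) [Field K] [NumberField K] (p : Nat.Primes)
    {s : ℂ} (hs : 0 < s.re) :
    DifferentiableAt ℂ (fun s : ℂ =>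
      ((splittingType K (p : ℕ)).map fun f : ℕ => (1 - (((p : ℕ) : ℂ) ^ (-s)) ^ f)⁻¹).prod *
        (1 - ((p : ℕ) : ℂ) ^ (-s))) s := by
  have hx : DifferentiableAt ℂ (fun s : ℂ => ((p : ℕ) : ℂ) ^ (-s)) s :=
    differentiableAt_id.neg.const_cpow (Or.inl (Nat.cast_ne_zero.mpr p.2.ne_zero))
  refine DifferentiableAt.mul ?_ ((differentiableAt_const _).sub hx)
  have key : ∀ M : Multiset ℕ, (∀ f ∈ M, 0 < f) → DifferentiableAt ℂ (fun s : ℂ =>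
      (M.map fun f : ℕ => (1 - (((p : ℕ) : ℂ) ^ (-s)) ^ f)⁻¹).prod) s := by
    intro M
    induction M using Multiset.induction_on with
    | empty =>
      intro _
      simp only [Multiset.map_zero, Multiset.prod_zero]
      exact differentiableAt_const _
    | cons a M ih =>
      intro hM
      simp only [Multiset.map_cons, Multiset.prod_cons]
      refine DifferentiableAt.mul ?_ (ih fun f hf => hM f (Multiset.mem_cons_of_mem hf))
      exact ((differentiableAt_const _).sub (hx.pow a)).inv
        (ctm_one_sub_pow_ne_zero p hs (hM a (Multiset.mem_cons_self a M)))
  exact key _ fun f hf => splittingType_pos p.2 hf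

/-- **Complete-then-multiply** (stub C of line `Sketch`).  Let `F_K(p,s) := (∏_{f ∈ splittingType K p}
(1 - p^{-fs})⁻¹)·(1 - p^{-s})`.  If for some finite `T`, some `σ₀` and some ENTIRE `g₀` one has
`HasProd_{p ∉ T} F_K(p,s) = g₀(s)` whenever `Re s > σ₀`, and `ζ_K` has the regrouped Euler
product on `Re s > 1`, then there is `g` holomorphic on `Re s > 0` with `g·ζ = ζ_K` on
`Re s > 1` (namely `g := g₀ · ∏_{p ∈ T} F_K(p,·)`). -/
theorem stub_completeThenMultiply (K : Type) [Field K] [NumberField K] (T : Finset Nat.Primes)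
    (σ₀ : ℝ) (g₀ : ℂ → ℂ) (hg₀ : Differentiable ℂ g₀)
    (hprod : ∀ s : ℂ, σ₀ < s.re →
      HasProd (fun p : {p : Nat.Primes // p ∉ T} =>
        ((splittingType K (p.1 : ℕ)).map fun f : ℕ => (1 - ((((p.1 : ℕ) : ℂ)) ^ (-s)) ^ f)⁻¹).prod *
          (1 - (((p.1 : ℕ) : ℂ)) ^ (-s))) (g₀ s))
    (hζK : ∀ s : ℂ, 1 < s.re →
      HasProd (fun p : Nat.Primes =>
        ((splittingType K p).map fun f : ℕ => (1 - (((p : ℕ) : ℂ) ^ (-s)) ^ f)⁻¹).prod)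
        (NumberField.dedekindZeta K s)) :
    ∃ g : ℂ → ℂ, DifferentiableOn ℂ g {s : ℂ | 0 < s.re} ∧
      ∀ s : ℂ, 1 < s.re → g s * riemannZeta s = NumberField.dedekindZeta K s := by
  -- the local factor `F_K(p,s)` and the completed function `g`
  set F : Nat.Primes → ℂ → ℂ := fun p s =>
    ((splittingType K (p : ℕ)).map fun f : ℕ => (1 - (((p : ℕ) : ℂ) ^ (-s)) ^ f)⁻¹).prod *
      (1 - ((p : ℕ) : ℂ) ^ (-s)) with hF
  set g : ℂ → ℂ := fun s => g₀ s * ∏ p ∈ T, F p s with hg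
  -- (i) `g` is differentiable at every `s` with `Re s > 0`
  have hgAt : ∀ s : ℂ, 0 < s.re → DifferentiableAt ℂ g s := fun s hs =>
    (hg₀ s).mul (DifferentiableAt.fun_finsetProd fun p _ => ctm_differentiableAt_factor K p hs)
  -- (ii) `g ζ = ζ_K` on `Re s > max σ₀ 1`
  have hfar : ∀ s : ℂ, max σ₀ 1 < s.re → g s * riemannZeta s = NumberField.dedekindZeta K s := by
    intro s hs
    have hσ : σ₀ < s.re := lt_of_le_of_lt (le_max_left _ _) hs
    have h1 : 1 < s.re := lt_of_le_of_lt (le_max_right _ _) hs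
    have h0 : 0 < s.re := lt_trans zero_lt_one h1
    -- complete the partial product by its finite part (monoid surgery)
    have htail : HasProd ((fun p : Nat.Primes => F p s) ∘ (↑) :
        ((↑T : Set Nat.Primes)ᶜ : Set Nat.Primes) → ℂ) (g₀ s) := hprod s hσ
    have hfull : HasProd (fun p : Nat.Primes => F p s) ((∏ p ∈ T, F p s) * g₀ s) :=
      (Finset.hasProd T (fun p : Nat.Primes => F p s)).mul_compl htail
    -- multiply by the Euler product of `ζ`
    have hmul := hfull.mul (riemannZeta_eulerProduct_hasProd h1)
    have heq : (fun p : Nat.Primes => F p s * (1 - ((p : ℕ) : ℂ) ^ (-s))⁻¹) =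
        fun p : Nat.Primes =>
          ((splittingType K p).map fun f : ℕ => (1 - (((p : ℕ) : ℂ) ^ (-s)) ^ f)⁻¹).prod := by
      funext p
      have hne : 1 - ((p : ℕ) : ℂ) ^ (-s) ≠ 0 := by
        simpa only [pow_one] using ctm_one_sub_pow_ne_zero p h0 Nat.one_pos
      exact mul_inv_cancel_right₀ hne _
    rw [heq] at hmul
    have huniq := hmul.unique (hζK s h1)
    calc g s * riemannZeta s = (∏ p ∈ T, F p s) * g₀ s * riemannZeta s := by
          show g₀ s * (∏ p ∈ T, F p s) * riemannZeta s = _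
          rw [mul_comm (g₀ s)]
      _ = NumberField.dedekindZeta K s := huniq
  -- (iii) identity principle on the half-plane `Re s > 1`; first, the raw Dirichlet series
  -- `ζ_K = LSeries (n ↦ #{I : N(I) = n})` is analytic there (abscissa of absolute convergence ≤ 1)
  have hZan : AnalyticOnNhd ℂ (NumberField.dedekindZeta K) {s : ℂ | 1 < s.re} := by
    have hZ : NumberField.dedekindZeta K =
        LSeries (fun n => (Nat.card {I : Ideal (𝓞 K) // Ideal.absNorm I = n} : ℂ)) := by
      funext s
      rfl
    have habs : LSeries.abscissaOfAbsConv
        (fun n => (Nat.card {I : Ideal (𝓞 K) // Ideal.absNorm I = n} : ℂ)) ≤ (1 : ℝ) :=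
      LSeries.abscissaOfAbsConv_le_of_forall_lt_LSeriesSummable fun y hy =>
        LSeriesSummable_dedekindZeta (K := K) (by simpa using hy)
    rw [hZ]
    exact (LSeries_analyticOnNhd _).mono fun s hs => lt_of_le_of_lt habs (by exact_mod_cast hs)
  have hU : IsOpen {s : ℂ | 1 < s.re} := isOpen_lt continuous_const Complex.continuous_re
  have hGan : AnalyticOnNhd ℂ (fun s => g s * riemannZeta s) {s : ℂ | 1 < s.re} := by
    refine DifferentiableOn.analyticOnNhd (fun s hs => ?_) hU
    have h1 : 1 < s.re := hs
    have hs1 : s ≠ 1 := by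
      rintro rfl
      simp at h1
    exact ((hgAt s (lt_trans zero_lt_one h1)).mul
      (differentiableAt_riemannZeta hs1)).differentiableWithinAt
  have hV : IsOpen {s : ℂ | max σ₀ 1 < s.re} := isOpen_lt continuous_const Complex.continuous_re
  set z₀ : ℂ := ((max σ₀ 1 + 1 : ℝ) : ℂ) with hz₀
  have hz₀U : z₀ ∈ {s : ℂ | 1 < s.re} := by
    show 1 < z₀.re
    rw [hz₀, Complex.ofReal_re]
    linarith [le_max_right σ₀ 1]
  have hz₀V : z₀ ∈ {s : ℂ | max σ₀ 1 < s.re} := by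
    show max σ₀ 1 < z₀.re
    rw [hz₀, Complex.ofReal_re]
    linarith
  have hev : (fun s => g s * riemannZeta s) =ᶠ[nhds z₀] NumberField.dedekindZeta K :=
    Filter.eventuallyEq_of_mem (hV.mem_nhds hz₀V) fun s hs => hfar s hs
  have hEq := hGan.eqOn_of_preconnected_of_eventuallyEq hZan
    (convex_halfSpace_re_gt 1).isPreconnected hz₀U hev
  refine ⟨g, fun s hs => (hgAt s hs).differentiableWithinAt, fun s hs => hEq hs⟩

end Summit.Langlands.Langlands.Theorems.DedekindQuotientEntire
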